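import Literature.MathematicalPhysics.QuantumLattice.SectorisedIncrementBoundGradedWeightedPrescribedPlateau
import Literature.MathematicalPhysics.QuantumLattice.GrassmannWeightedEffectiveActionGradedTruncationOrientedDB
import HarnessLib

/-!
# The orders `≥ 2` of the single-scale increment, GRADED, DECAY-WEIGHTED, prescribed output SECTORS and ORIENTED tree lines: generic labels

Topic `Literature/MathematicalPhysics/QuantumLattice`; the oriented twin of §1 of `SectorisedIncrementBoundGradedWeightedPrescribedPlateau`
(Benfatto–Giuliani–Mastropietro 2006, (2.61)–(2.63), (2.66), (2.71a), (2.77)–(2.84), (2.88)–(2.90), §2.8 (2.97)–(2.98), App. A4 (A4.8),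
§3 (3.2)–(3.8)): the weighted prescribed supplier `sum_wt_norm_kernel_effAction_sub_gaussConv_le_graded_oriented_of_gramBounded` read
through a substitution `f` of the fields and a reading `g` of the output legs (Young's inequality with prescribed legs,
`sum_filter_wt_norm_kernel_map_prescribed_le`).  The levelled input norms, the talking relation and the oracle over the readings of the
anchored trees ride along unchanged.

* `sum_filter_wt_norm_kernel_map_effAction_sub_gaussConv_le_graded_oriented_of_gramBounded` — the generic oriented door.

Everything is proved; no definition, no named fact.

## Sources

G. Benfatto, A. Giuliani, V. Mastropietro, Ann. Henri Poincaré 7 (2006) 809–898, (2.61)–(2.63), (2.66), (2.71a), (2.77)–(2.84),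
(2.88)–(2.90), §2.8, App. A4 (A4.8), §3 (3.2)–(3.8) [`BenfattoGiulianiMastropietro2006`].
-/

noncomputable section

namespace Literature.MathematicalPhysics.QuantumLattice

open GrassmannAlgebra Finset Literature.Probability.LatticeModels Literature.Probability.LatticeModels.BattleFederbush
open scoped Nat

universe u

section Generic

variable {𝕜 : Type*} [RCLike 𝕜] {Γ Γ' Γ'' : Type u} {Λ : Type*} [Fintype Γ] [DecidableEq Γ] [Fintype Γ'] [DecidableEq Γ']
  [Fintype Γ''] [DecidableEq Γ''] [DecidableEq Λ] {wt : Finset Λ → ℝ} {Sec : Type*} [Fintype Sec] [DecidableEq Sec]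

omit [DecidableEq Γ'] [Fintype Sec] [DecidableEq Sec] in
/-- Nonnegativity of the graded-oriented right side (helper). [folklore] -/
private theorem gradedOrientedRHS_nonneg (Γ' : Type u) [Fintype Γ'] {κ α cα ρ : ℝ} (hκ : 0 < κ) (hα : 0 ≤ α) (hcα : 0 ≤ cα)
    (hρ : 0 ≤ ρ) {m : ℕ} (J : Finset (Fin (m + 1))) (Npl : ℕ → ℝ) (hNpl0 : ∀ m', 0 ≤ Npl m')
    (Nφ : (n : ℕ) → (Fin n → ℕ) → (J → Fin n) → ℝ) (hNφ0 : ∀ n δ pf, 0 ≤ Nφ n δ pf)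
    (hθ : Real.exp 1 * α * normV Γ' κ ρ Npl / κ ^ 2 < 1) (N₀ : ℕ) :
    0 ≤ ∑ n ∈ Ico 2 N₀, (κ⁻¹ ^ (m + 1) * κ⁻¹ ^ (2 * (n - 1)) * (cα ^ (n - 1) * Real.exp n)) *
          ∑ δ ∈ (Fintype.piFinset fun _ : Fin n => range (Fintype.card Γ' / 2 + 1)) with m + 1 + 2 * (n - 1) ≤ ∑ a, 2 * δ a,
            ∑ pf : J → Fin n, ((∏ j, ((2 * δ (pf j) : ℕ) : ℝ)) / ((∑ a, 2 * δ a : ℕ) : ℝ) ^ J.card) *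
              ((Real.exp 3 * κ) ^ (∑ a, 2 * δ a) * Nφ n δ pf) +
        ρ⁻¹ ^ (m + 1) * (Real.exp 1 * normV Γ' κ ρ Npl) *
          (Real.exp 1 * α * normV Γ' κ ρ Npl / κ ^ 2) ^ (N₀ - 1) / (1 - Real.exp 1 * α * normV Γ' κ ρ Npl / κ ^ 2) := by
  have hV0 : 0 ≤ normV Γ' κ ρ Npl := normV_nonneg hκ.le hρ hNpl0
  refine add_nonneg (sum_nonneg fun n _ => mul_nonneg (by positivity) (sum_nonneg fun δ _ => sum_nonneg fun pf _ =>
    mul_nonneg (by positivity) (mul_nonneg (by positivity) (hNφ0 _ _ _)))) ?_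
  exact div_nonneg (by positivity) (by linarith)

/-- **The graded orders `≥ 2` with PRESCRIBED output sectors, WEIGHTED output positions and ORIENTED tree lines, read through `(f, g)`**
(BGM 2006 (2.61)–(2.63), (2.66), (2.77)–(2.84), (2.88)–(2.90), §2.8, App. A4 (A4.8), §3).  As
`sum_filter_wt_norm_kernel_map_effAction_sub_gaussConv_le_graded_prescribed_of_gramBounded`, with: sectors `sec : Γ′ → Sec` of the auxiliary
fields and a talking relation `ov` (at most `c` partners) supporting `C′ = fᵀ C f`; the input through its plain WEIGHTED anchored norms
`Npl(m′)` (tail) and its LEVELLED ones `N(m′, F)` (`hN`: any legs sector-prescribed, one further free leg pinned; `hNsw`: the same leg pinned in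
position only); predicates `A j` on `Γ′` forcing the sectors `σp j`; oracles `Nφ n δ pf` over the readings of the anchored trees.  Then
`Σ_{X″_p = w″, P j (X″_j)} wt(π″X″)·‖kernel_{m+1}(map g (effAction C (map f Ṽ) − e^{Δ_C}(map f Ṽ)))(X″)‖ ≤ cr·cc^m·[graded-oriented + tail]`.
[cite: BenfattoGiulianiMastropietro2006, (2.61)-(2.63), (2.66), (2.84), (2.88)-(2.90), (2.97)-(2.98), (A4.8), (3.2)-(3.8)] -/
theorem sum_filter_wt_norm_kernel_map_effAction_sub_gaussConv_le_graded_oriented_of_gramBounded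
    (hwt : IsTreeWeight wt) (π' : Γ' → Λ) (π'' : Γ'' → Λ)
    (C : Matrix Γ Γ 𝕜) (f : (Γ' → 𝕜) →ₗ[𝕜] (Γ → 𝕜)) (g : (Γ → 𝕜) →ₗ[𝕜] (Γ'' → 𝕜))
    (Vt : GrassmannAlgebra 𝕜 Γ') (hVt : Vt ∈ evenPart 𝕜 Γ') (hVt0 : constPart 𝕜 Vt = 0)
    {κ : ℝ} (hκ : 0 < κ) (hGB : IsGramBoundedR ((LinearMap.toMatrix' f).transpose * C * LinearMap.toMatrix' f) κ)
    (sec : Γ' → Sec) (ov : Sec → Sec → Prop) [DecidableRel ov] {c : ℕ} (hc1 : 1 ≤ c)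
    (hov : ∀ σ' : Sec, (univ.filter fun σ : Sec => ov σ σ').card ≤ c)
    (hCov : ∀ X Y, ((LinearMap.toMatrix' f).transpose * C * LinearMap.toMatrix' f) X Y ≠ 0 → ov (sec X) (sec Y) ∧ ov (sec Y) (sec X))
    {m : ℕ} (p : Fin (m + 1)) (J : Finset (Fin (m + 1))) (hp : p ∉ J) (P : Fin (m + 1) → Γ'' → Prop) [∀ j, DecidablePred (P j)]
    (A : Fin (m + 1) → Γ' → Bool) (σp : Fin (m + 1) → Sec) (hA : ∀ j ∈ J, ∀ y, A j y = true → sec y = σp j)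
    (hPA : ∀ j ∈ J, ∀ (y'' : Γ'') (x' : Γ'), P j y'' → (LinearMap.toMatrix' g * LinearMap.toMatrix' f) y'' x' ≠ 0 → A j x' = true)
    (Npl : ℕ → ℝ) (hNpl0 : ∀ m', 0 ≤ Npl m')
    (hNplain : ∀ (m' : ℕ) (j : Fin (2 * m')) (w : Γ'),
      ∑ Y ∈ univ.filter (fun Y : Fin (2 * m') → Γ' => Y j = w), ‖kernel 𝕜 Vt (2 * m') Y‖ * wt ((univ.image Y).image π') ≤ Npl m')
    (N : ℕ → ℕ → ℝ) (hN0 : ∀ m' F, 0 ≤ N m' F)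
    (hN : ∀ (m' : ℕ) (ρc : Fin (2 * m') → Option Sec) (t : Fin (2 * m')), ρc t = none → ∀ a : Γ',
      ∑ Y ∈ univ.filter (fun Y : Fin (2 * m') → Γ' => Y t = a),
        (if ∀ j' σ, ρc j' = some σ → sec (Y j') = σ then ‖kernel 𝕜 Vt (2 * m') Y‖ * wt ((univ.image Y).image π') else 0) ≤
        N m' ((univ.filter fun j' : Fin (2 * m') => ρc j' ≠ none).card + 1))
    (hNsw : ∀ (m' : ℕ) (ρc : Fin (2 * m') → Option Sec) (t : Fin (2 * m')), ρc t = none →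
      ∃ g₀ : Sec → ℝ, (∀ σ, 0 ≤ g₀ σ) ∧
      (∀ a : Γ', ∑ Y ∈ univ.filter (fun Y : Fin (2 * m') → Γ' => Y t = a),
        (if ∀ j' σ, ρc j' = some σ → sec (Y j') = σ then ‖kernel 𝕜 Vt (2 * m') Y‖ * wt ((univ.image Y).image π') else 0) ≤
          g₀ (sec a)) ∧
      ∑ σ, g₀ σ ≤ N m' (univ.filter fun j' : Fin (2 * m') => ρc j' ≠ none).card)
    (Nφ : (n : ℕ) → (Fin n → ℕ) → (J → Fin n) → ℝ) (hNφ0 : ∀ n δ pf, 0 ≤ Nφ n δ pf)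
    (hNφ : ∀ (n : ℕ) (δ : Fin n → ℕ) (b : Fin n) {k : ℕ} (s : Script b k), s.Valid → univ.image s.y = univ → ∀ pf : J → Fin n,
      ∃ o : Fin n → Bool, ∏ a, N (δ a) ((univ.filter fun j : J => pf j = a).card +
        swChildren s o a + if a = b ∨ o a = true then 1 else 0) ≤ Nφ n δ pf)
    {α : ℝ} (hα : 0 < α)
    (hrow : ∀ X, ∑ Y, ‖((LinearMap.toMatrix' f).transpose * C * LinearMap.toMatrix' f) X Y‖ * wt {π' X, π' Y} ≤ α)
    (hcol : ∀ Y, ∑ X, ‖((LinearMap.toMatrix' f).transpose * C * LinearMap.toMatrix' f) X Y‖ * wt {π' X, π' Y} ≤ α)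
    {ρ : ℝ} (hρ : 0 < ρ) (hθ : Real.exp 1 * α * normV Γ' κ ρ Npl / κ ^ 2 < 1)
    {cr cc : ℝ} (hcc0 : 0 ≤ cc)
    (hrow' : ∀ X'', ∑ X', ‖(LinearMap.toMatrix' g * LinearMap.toMatrix' f) X'' X'‖ * wt {π'' X'', π' X'} ≤ cr)
    (hcol' : ∀ X', ∑ X'', ‖(LinearMap.toMatrix' g * LinearMap.toMatrix' f) X'' X'‖ * wt {π'' X'', π' X'} ≤ cc)
    {N₀ : ℕ} (hN₀ : 2 ≤ N₀) (w'' : Γ'') :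
    ∑ X'' ∈ univ.filter (fun X'' : Fin (m + 1) → Γ'' => X'' p = w'' ∧ ∀ j ∈ J, P j (X'' j)), wt ((univ.image X'').image π'') *
        ‖kernel 𝕜 (ExteriorAlgebra.map g
          (effAction 𝕜 C (ExteriorAlgebra.map f Vt) - gaussConv 𝕜 C (ExteriorAlgebra.map f Vt))) (m + 1) X''‖ ≤
      cr * cc ^ m *
        (∑ n ∈ Ico 2 N₀, (κ⁻¹ ^ (m + 1) * κ⁻¹ ^ (2 * (n - 1)) * ((c * α) ^ (n - 1) * Real.exp n)) *
            ∑ δ ∈ (Fintype.piFinset fun _ : Fin n => range (Fintype.card Γ' / 2 + 1)) with m + 1 + 2 * (n - 1) ≤ ∑ a, 2 * δ a,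
              ∑ pf : J → Fin n, ((∏ j, ((2 * δ (pf j) : ℕ) : ℝ)) / ((∑ a, 2 * δ a : ℕ) : ℝ) ^ J.card) *
                ((Real.exp 3 * κ) ^ (∑ a, 2 * δ a) * Nφ n δ pf) +
          ρ⁻¹ ^ (m + 1) * (Real.exp 1 * normV Γ' κ ρ Npl) *
            (Real.exp 1 * α * normV Γ' κ ρ Npl / κ ^ 2) ^ (N₀ - 1) / (1 - Real.exp 1 * α * normV Γ' κ ρ Npl / κ ^ 2)) := by
  set C' : Matrix Γ' Γ' 𝕜 := (LinearMap.toMatrix' f).transpose * C * LinearMap.toMatrix' f with hC'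
  -- the weight pulled back to the auxiliary labels is a tree weight
  set wt' : Finset Γ' → ℝ := fun S => wt (S.image π') with hwt'
  have hwt'tree : IsTreeWeight wt' := hwt.comap π'
  have hpair : ∀ X Y : Γ', wt' {X, Y} = wt {π' X, π' Y} := fun X Y => by
    simp only [hwt', image_insert, image_singleton]
  have hrow₁ : ∀ X, ∑ Y, ‖C' X Y‖ * wt' {X, Y} ≤ α := fun X => by simpa only [hpair] using hrow X
  have hcol₁ : ∀ Y, ∑ X, ‖C' X Y‖ * wt' {X, Y} ≤ α := fun Y => by simpa only [hpair] using hcol Y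
  -- the weighted oriented supplier in the auxiliary representation, for every pin
  have hK : ∀ a : Γ', ∑ W ∈ univ.filter (fun W : Fin (m + 1) → Γ' => W p = a ∧ ∀ j ∈ J, A j (W j) = true),
      ‖kernel 𝕜 (effAction 𝕜 C' Vt - gaussConv 𝕜 C' Vt) (m + 1) W‖ * wt ((univ.image W).image π') ≤
      ∑ n ∈ Ico 2 N₀, (κ⁻¹ ^ (m + 1) * κ⁻¹ ^ (2 * (n - 1)) * ((c * α) ^ (n - 1) * Real.exp n)) *
          ∑ δ ∈ (Fintype.piFinset fun _ : Fin n => range (Fintype.card Γ' / 2 + 1)) with m + 1 + 2 * (n - 1) ≤ ∑ a, 2 * δ a,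
            ∑ pf : J → Fin n, ((∏ j, ((2 * δ (pf j) : ℕ) : ℝ)) / ((∑ a, 2 * δ a : ℕ) : ℝ) ^ J.card) *
              ((Real.exp 3 * κ) ^ (∑ a, 2 * δ a) * Nφ n δ pf) +
        ρ⁻¹ ^ (m + 1) * (Real.exp 1 * normV Γ' κ ρ Npl) *
          (Real.exp 1 * α * normV Γ' κ ρ Npl / κ ^ 2) ^ (N₀ - 1) / (1 - Real.exp 1 * α * normV Γ' κ ρ Npl / κ ^ 2) := by
    intro a
    have h := sum_wt_norm_kernel_effAction_sub_gaussConv_le_graded_oriented_of_gramBounded (C := C') hwt'tree hκ hGB Vt hVt hVt0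
      sec ov hc1 hov hCov J A σp hA Npl hNpl0 hNplain N hN0 hN hNsw Nφ hNφ0 hNφ hα hrow₁ hcol₁ hρ hθ hN₀ (Nat.succ_pos m) p hp a
    exact le_of_eq_of_le (sum_congr rfl fun W _ => mul_comm _ _) h
  have hB0 := gradedOrientedRHS_nonneg Γ' hκ hα.le (mul_nonneg (Nat.cast_nonneg c) hα.le) hρ.le J Npl hNpl0 Nφ hNφ0 hθ N₀
  -- read through `g ∘ f`
  have hsub : effAction 𝕜 C (ExteriorAlgebra.map f Vt) - gaussConv 𝕜 C (ExteriorAlgebra.map f Vt) =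
      ExteriorAlgebra.map f (effAction 𝕜 C' Vt - gaussConv 𝕜 C' Vt) := by
    rw [effAction_map, gaussConv_map, map_sub]
  rw [hsub, map_map_eq_map_comp]
  exact sum_filter_wt_norm_kernel_map_prescribed_le hwt π' π'' (g ∘ₗ f) hcc0
    (by intro X''; rw [LinearMap.toMatrix'_comp]; exact hrow' X'')
    (by intro X'; simp only [LinearMap.toMatrix'_comp]; exact hcol' X') (effAction 𝕜 C' Vt - gaussConv 𝕜 C' Vt) m p J P A
    (by intro j hj y'' x' hPj hne; rw [LinearMap.toMatrix'_comp] at hne; exact hPA j hj y'' x' hPj hne) hB0 hK w''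

/-- **The graded orders `≥ 2` with output legs prescribed to PARENT SETS of sectors, WEIGHTED output positions and ORIENTED tree lines, read
through `(f, g)`** (as `sum_filter_wt_norm_kernel_map_effAction_sub_gaussConv_le_graded_oriented_of_gramBounded`, the input predicate of the
prescribed leg `j` being `sec x′ ∈ Par j` — a fine output label overlaps several coarse sectors, its parents; the constrained input sum is
expanded over the parent choices `s ∈ ∏_{j∈J} Par j`, each a single-sector prescription, at the cost of the factor `∏_{j∈J} |Par j|`).
**Original single-sector form:**
(BGM 2006 (2.61)–(2.63), (2.66), (2.77)–(2.84), (2.88)–(2.90), §2.8, App. A4 (A4.8), §3).  As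
`sum_filter_wt_norm_kernel_map_effAction_sub_gaussConv_le_graded_prescribed_of_gramBounded`, with: sectors `sec : Γ′ → Sec` of the auxiliary
fields and a talking relation `ov` (at most `c` partners) supporting `C′ = fᵀ C f`; the input through its plain WEIGHTED anchored norms
`Npl(m′)` (tail) and its LEVELLED ones `N(m′, F)` (`hN`: any legs sector-prescribed, one further free leg pinned; `hNsw`: the same leg pinned in
position only); predicates `A j` on `Γ′` forcing the sectors `σp j`; oracles `Nφ n δ pf` over the readings of the anchored trees.  Then
`Σ_{X″_p = w″, P j (X″_j)} wt(π″X″)·‖kernel_{m+1}(map g (effAction C (map f Ṽ) − e^{Δ_C}(map f Ṽ)))(X″)‖ ≤ cr·cc^m·[graded-oriented + tail]`.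
[cite: BenfattoGiulianiMastropietro2006, (2.61)-(2.63), (2.66), (2.84), (2.88)-(2.90), (2.97)-(2.98), (A4.8), (3.2)-(3.8)] -/
theorem sum_filter_wt_norm_kernel_map_effAction_sub_gaussConv_le_graded_oriented_parents_of_gramBounded
    (hwt : IsTreeWeight wt) (π' : Γ' → Λ) (π'' : Γ'' → Λ)
    (C : Matrix Γ Γ 𝕜) (f : (Γ' → 𝕜) →ₗ[𝕜] (Γ → 𝕜)) (g : (Γ → 𝕜) →ₗ[𝕜] (Γ'' → 𝕜))
    (Vt : GrassmannAlgebra 𝕜 Γ') (hVt : Vt ∈ evenPart 𝕜 Γ') (hVt0 : constPart 𝕜 Vt = 0)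
    {κ : ℝ} (hκ : 0 < κ) (hGB : IsGramBoundedR ((LinearMap.toMatrix' f).transpose * C * LinearMap.toMatrix' f) κ)
    (sec : Γ' → Sec) (ov : Sec → Sec → Prop) [DecidableRel ov] {c : ℕ} (hc1 : 1 ≤ c)
    (hov : ∀ σ' : Sec, (univ.filter fun σ : Sec => ov σ σ').card ≤ c)
    (hCov : ∀ X Y, ((LinearMap.toMatrix' f).transpose * C * LinearMap.toMatrix' f) X Y ≠ 0 → ov (sec X) (sec Y) ∧ ov (sec Y) (sec X))
    {m : ℕ} (p : Fin (m + 1)) (J : Finset (Fin (m + 1))) (hp : p ∉ J) (P : Fin (m + 1) → Γ'' → Prop) [∀ j, DecidablePred (P j)]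
    (Par : Fin (m + 1) → Finset Sec)
    (hPA : ∀ j ∈ J, ∀ (y'' : Γ'') (x' : Γ'), P j y'' → (LinearMap.toMatrix' g * LinearMap.toMatrix' f) y'' x' ≠ 0 → sec x' ∈ Par j)
    (Npl : ℕ → ℝ) (hNpl0 : ∀ m', 0 ≤ Npl m')
    (hNplain : ∀ (m' : ℕ) (j : Fin (2 * m')) (w : Γ'),
      ∑ Y ∈ univ.filter (fun Y : Fin (2 * m') → Γ' => Y j = w), ‖kernel 𝕜 Vt (2 * m') Y‖ * wt ((univ.image Y).image π') ≤ Npl m')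
    (N : ℕ → ℕ → ℝ) (hN0 : ∀ m' F, 0 ≤ N m' F)
    (hN : ∀ (m' : ℕ) (ρc : Fin (2 * m') → Option Sec) (t : Fin (2 * m')), ρc t = none → ∀ a : Γ',
      ∑ Y ∈ univ.filter (fun Y : Fin (2 * m') → Γ' => Y t = a),
        (if ∀ j' σ, ρc j' = some σ → sec (Y j') = σ then ‖kernel 𝕜 Vt (2 * m') Y‖ * wt ((univ.image Y).image π') else 0) ≤
        N m' ((univ.filter fun j' : Fin (2 * m') => ρc j' ≠ none).card + 1))
    (hNsw : ∀ (m' : ℕ) (ρc : Fin (2 * m') → Option Sec) (t : Fin (2 * m')), ρc t = none →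
      ∃ g₀ : Sec → ℝ, (∀ σ, 0 ≤ g₀ σ) ∧
      (∀ a : Γ', ∑ Y ∈ univ.filter (fun Y : Fin (2 * m') → Γ' => Y t = a),
        (if ∀ j' σ, ρc j' = some σ → sec (Y j') = σ then ‖kernel 𝕜 Vt (2 * m') Y‖ * wt ((univ.image Y).image π') else 0) ≤
          g₀ (sec a)) ∧
      ∑ σ, g₀ σ ≤ N m' (univ.filter fun j' : Fin (2 * m') => ρc j' ≠ none).card)
    (Nφ : (n : ℕ) → (Fin n → ℕ) → (J → Fin n) → ℝ) (hNφ0 : ∀ n δ pf, 0 ≤ Nφ n δ pf)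
    (hNφ : ∀ (n : ℕ) (δ : Fin n → ℕ) (b : Fin n) {k : ℕ} (s : Script b k), s.Valid → univ.image s.y = univ → ∀ pf : J → Fin n,
      ∃ o : Fin n → Bool, ∏ a, N (δ a) ((univ.filter fun j : J => pf j = a).card +
        swChildren s o a + if a = b ∨ o a = true then 1 else 0) ≤ Nφ n δ pf)
    {α : ℝ} (hα : 0 < α)
    (hrow : ∀ X, ∑ Y, ‖((LinearMap.toMatrix' f).transpose * C * LinearMap.toMatrix' f) X Y‖ * wt {π' X, π' Y} ≤ α)
    (hcol : ∀ Y, ∑ X, ‖((LinearMap.toMatrix' f).transpose * C * LinearMap.toMatrix' f) X Y‖ * wt {π' X, π' Y} ≤ α)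
    {ρ : ℝ} (hρ : 0 < ρ) (hθ : Real.exp 1 * α * normV Γ' κ ρ Npl / κ ^ 2 < 1)
    {cr cc : ℝ} (hcc0 : 0 ≤ cc)
    (hrow' : ∀ X'', ∑ X', ‖(LinearMap.toMatrix' g * LinearMap.toMatrix' f) X'' X'‖ * wt {π'' X'', π' X'} ≤ cr)
    (hcol' : ∀ X', ∑ X'', ‖(LinearMap.toMatrix' g * LinearMap.toMatrix' f) X'' X'‖ * wt {π'' X'', π' X'} ≤ cc)
    {N₀ : ℕ} (hN₀ : 2 ≤ N₀) (w'' : Γ'') :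
    ∑ X'' ∈ univ.filter (fun X'' : Fin (m + 1) → Γ'' => X'' p = w'' ∧ ∀ j ∈ J, P j (X'' j)), wt ((univ.image X'').image π'') *
        ‖kernel 𝕜 (ExteriorAlgebra.map g
          (effAction 𝕜 C (ExteriorAlgebra.map f Vt) - gaussConv 𝕜 C (ExteriorAlgebra.map f Vt))) (m + 1) X''‖ ≤
      cr * cc ^ m * ((∏ j ∈ J, ((Par j).card : ℝ)) *
        (∑ n ∈ Ico 2 N₀, (κ⁻¹ ^ (m + 1) * κ⁻¹ ^ (2 * (n - 1)) * ((c * α) ^ (n - 1) * Real.exp n)) *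
            ∑ δ ∈ (Fintype.piFinset fun _ : Fin n => range (Fintype.card Γ' / 2 + 1)) with m + 1 + 2 * (n - 1) ≤ ∑ a, 2 * δ a,
              ∑ pf : J → Fin n, ((∏ j, ((2 * δ (pf j) : ℕ) : ℝ)) / ((∑ a, 2 * δ a : ℕ) : ℝ) ^ J.card) *
                ((Real.exp 3 * κ) ^ (∑ a, 2 * δ a) * Nφ n δ pf) +
          ρ⁻¹ ^ (m + 1) * (Real.exp 1 * normV Γ' κ ρ Npl) *
            (Real.exp 1 * α * normV Γ' κ ρ Npl / κ ^ 2) ^ (N₀ - 1) / (1 - Real.exp 1 * α * normV Γ' κ ρ Npl / κ ^ 2))) := by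
  classical
  set C' : Matrix Γ' Γ' 𝕜 := (LinearMap.toMatrix' f).transpose * C * LinearMap.toMatrix' f with hC'
  -- the weight pulled back to the auxiliary labels is a tree weight
  set wt' : Finset Γ' → ℝ := fun S => wt (S.image π') with hwt'
  have hwt'tree : IsTreeWeight wt' := hwt.comap π'
  have hpair : ∀ X Y : Γ', wt' {X, Y} = wt {π' X, π' Y} := fun X Y => by
    simp only [hwt', image_insert, image_singleton]
  have hrow₁ : ∀ X, ∑ Y, ‖C' X Y‖ * wt' {X, Y} ≤ α := fun X => by simpa only [hpair] using hrow X
  have hcol₁ : ∀ Y, ∑ X, ‖C' X Y‖ * wt' {X, Y} ≤ α := fun Y => by simpa only [hpair] using hcol Y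
  -- abbreviation of the single-sector right side
  set R : ℝ := ∑ n ∈ Ico 2 N₀, (κ⁻¹ ^ (m + 1) * κ⁻¹ ^ (2 * (n - 1)) * ((c * α) ^ (n - 1) * Real.exp n)) *
          ∑ δ ∈ (Fintype.piFinset fun _ : Fin n => range (Fintype.card Γ' / 2 + 1)) with m + 1 + 2 * (n - 1) ≤ ∑ a, 2 * δ a,
            ∑ pf : J → Fin n, ((∏ j, ((2 * δ (pf j) : ℕ) : ℝ)) / ((∑ a, 2 * δ a : ℕ) : ℝ) ^ J.card) *
              ((Real.exp 3 * κ) ^ (∑ a, 2 * δ a) * Nφ n δ pf) +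
        ρ⁻¹ ^ (m + 1) * (Real.exp 1 * normV Γ' κ ρ Npl) *
          (Real.exp 1 * α * normV Γ' κ ρ Npl / κ ^ 2) ^ (N₀ - 1) / (1 - Real.exp 1 * α * normV Γ' κ ρ Npl / κ ^ 2) with hR
  have hR0 : 0 ≤ R := gradedOrientedRHS_nonneg Γ' hκ hα.le (mul_nonneg (Nat.cast_nonneg c) hα.le) hρ.le J Npl hNpl0 Nφ hNφ0 hθ N₀
  -- the single-sector supplier, for every parent choice and pin
  have hKs : ∀ (s : J → Sec) (a : Γ'),
      ∑ W ∈ univ.filter (fun W : Fin (m + 1) → Γ' => W p = a ∧ ∀ j ∈ J,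
        (decide (sec (W j) ∈ Par j) && decide (∀ h : j ∈ J, sec (W j) = s ⟨j, h⟩)) = true),
      ‖kernel 𝕜 (effAction 𝕜 C' Vt - gaussConv 𝕜 C' Vt) (m + 1) W‖ * wt ((univ.image W).image π') ≤ R := by
    intro s a
    have h := sum_wt_norm_kernel_effAction_sub_gaussConv_le_graded_oriented_of_gramBounded (C := C') hwt'tree hκ hGB Vt hVt hVt0
      sec ov hc1 hov hCov J (fun j y => decide (sec y ∈ Par j) && decide (∀ h : j ∈ J, sec y = s ⟨j, h⟩))
      (fun j => if h : j ∈ J then s ⟨j, h⟩ else sec a) ?_ Npl hNpl0 hNplain N hN0 hN hNsw Nφ hNφ0 hNφ hα hrow₁ hcol₁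
      hρ hθ hN₀ (Nat.succ_pos m) p hp a
    · rw [hR]
      exact le_of_eq_of_le (sum_congr rfl fun W _ => mul_comm _ _) h
    · intro j hj y hy
      simp only [Bool.and_eq_true, decide_eq_true_eq] at hy
      rw [dif_pos hj]
      exact hy.2 hj
  -- the parent-set constrained sum expanded over the parent choices
  have hK : ∀ a : Γ', ∑ W ∈ univ.filter (fun W : Fin (m + 1) → Γ' => W p = a ∧ ∀ j ∈ J, decide (sec (W j) ∈ Par j) = true),
      ‖kernel 𝕜 (effAction 𝕜 C' Vt - gaussConv 𝕜 C' Vt) (m + 1) W‖ * wt ((univ.image W).image π') ≤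
      (∏ j ∈ J, ((Par j).card : ℝ)) * R := by
    intro a
    set f : (Fin (m + 1) → Γ') → ℝ := fun W =>
      ‖kernel 𝕜 (effAction 𝕜 C' Vt - gaussConv 𝕜 C' Vt) (m + 1) W‖ * wt ((univ.image W).image π') with hf
    have hf0 : ∀ W, 0 ≤ f W := fun W => mul_nonneg (norm_nonneg _) (hwt.nonneg _)
    set key : (Fin (m + 1) → Γ') → (J → Sec) := fun W j => sec (W j) with hkey
    set Wset := univ.filter (fun W : Fin (m + 1) → Γ' => W p = a ∧ ∀ j ∈ J, decide (sec (W j) ∈ Par j) = true) with hWset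
    have hmaps : ∀ W ∈ Wset, key W ∈ Fintype.piFinset fun j : J => Par j := by
      intro W hW
      rw [Fintype.mem_piFinset]
      intro j
      have h := (mem_filter.1 hW).2.2 j j.2
      rw [decide_eq_true_eq] at h
      exact h
    calc ∑ W ∈ Wset, f W
        = ∑ s ∈ Fintype.piFinset (fun j : J => Par j), ∑ W ∈ Wset.filter (fun W => key W = s), f W :=
          (sum_fiberwise_of_maps_to hmaps f).symm
      _ ≤ ∑ s ∈ Fintype.piFinset (fun j : J => Par j), R := by
          refine sum_le_sum fun s _ => ?_
          refine le_trans (sum_le_sum_of_subset_of_nonneg (fun W hW => ?_) fun W _ _ => hf0 W) (hKs s a)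
          rw [mem_filter] at hW
          obtain ⟨hW1, hW2⟩ := hW
          obtain ⟨hWp, hWJ⟩ := (mem_filter.1 hW1).2
          rw [mem_filter]
          refine ⟨mem_univ _, hWp, fun j hj => ?_⟩
          rw [Bool.and_eq_true]
          refine ⟨hWJ j hj, ?_⟩
          rw [decide_eq_true_eq]
          intro h
          have := congrFun hW2 ⟨j, h⟩
          exact this
      _ = (∏ j ∈ J, ((Par j).card : ℝ)) * R := by
          rw [sum_const, nsmul_eq_mul, Fintype.card_piFinset, Nat.cast_prod, ← prod_coe_sort J (fun j => ((Par j).card : ℝ))]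
  have hB0 : 0 ≤ (∏ j ∈ J, ((Par j).card : ℝ)) * R := mul_nonneg (prod_nonneg fun j _ => Nat.cast_nonneg _) hR0
  -- read through `g ∘ f`
  have hsub : effAction 𝕜 C (ExteriorAlgebra.map f Vt) - gaussConv 𝕜 C (ExteriorAlgebra.map f Vt) =
      ExteriorAlgebra.map f (effAction 𝕜 C' Vt - gaussConv 𝕜 C' Vt) := by
    rw [effAction_map, gaussConv_map, map_sub]
  rw [hsub, map_map_eq_map_comp]
  exact sum_filter_wt_norm_kernel_map_prescribed_le hwt π' π'' (g ∘ₗ f) hcc0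
    (by intro X''; rw [LinearMap.toMatrix'_comp]; exact hrow' X'')
    (by intro X'; simp only [LinearMap.toMatrix'_comp]; exact hcol' X') (effAction 𝕜 C' Vt - gaussConv 𝕜 C' Vt) m p J P
    (fun j y => decide (sec y ∈ Par j))
    (by intro j hj y'' x' hPj hne; rw [LinearMap.toMatrix'_comp] at hne; rw [decide_eq_true_eq]; exact hPA j hj y'' x' hPj hne)
    hB0 hK w''

end Generic

end Literature.MathematicalPhysics.QuantumLattice
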